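import Summits.ValiantsHypothesis.ValiantsHypothesis.Theorems.KPlusLogSqLawTropicalBStaircaseDesign
import Summits.ValiantsHypothesis.ValiantsHypothesis.Theorems.KPlusLogSqLawTropicalBSplitDefs

/-!
# `TropicalB` — calibration: there is no `K`-AXIS doubling law, not even eventually in `K` (the staircase kills it)

HONEST FRAMING.  Object-search cell `pub-symmetroid` (Valiant); helper bookkeeping for the OPEN crux `TropicalB`
(stmt-ValiantsHypothesis-19771, route `KPlusLogSqLaw`) in tropical census currency (`TropicalCensus.TropRootLawAt`).  Source: the
ideation seat's memo `HOME/pub-symmetroid-conjb-2/g8/ROUND1f-MEMO-g8.md` §3 («dead on paper: the K-axis doubling law»; desk R1571 §3: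
optional kernel calibration).  Nothing here asserts `TropicalB`, any doubling law, Conjecture B, `MatrixDescartes`
(stmt-ValiantsHypothesis-18050) or anything on `VP ≠ VNP`; no stub is touched.

The `m`-axis (size) doubling laws of `Cruxes/TropicalB/Lines/doubling.lean` / `…square-doubling.lean` split a format `(a+e, K)` into
`(a, K)` and `(e, K)`.  The `K`-AXIS analogue «`T(m, 2K) + 1 ≤ 2^{C·K} · m^c · (T(m, K) + 1)`» would ALSO give the crux (iterate from
`T(m, 1) = 0`, or from slope counting at any fixed `K₁`: `T(m, K) ≤ 2^{O(K)} · m^{c log₂ K + O(1)}` along `K = K₁·2^j`, and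
`log₂ K ≤ log₂ m` in the relevant window), but it is FALSE for every `(C, c)`, and even when asked only for `K ≥ K₀`
(`KDoublingLawFrom K₀ C c`): iterating it `j` times from the slope-counting base `T(m, K₁) ≤ 2^{K₁²}·m^{K₁}` at `K₁ = 2^{K₀}` bounds
`T(m, K₁·2^j) ≤ 2^{(C+1)·K₁·2^j + K₁²} · m^{c·j + K₁}` (`tropRootLawAt_iter_of_kDoublingLawFrom`), while the tree's staircase design
(`WalkDesign.staircase_lower`: format `(m, L+1)` with `m ≤ 2^{2L+2}·n²` has `≥ n^L − 1` breakpoints) beats any bound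
`2^{A}·m^{b}` with `L ≥ 2b + 1` for `n` large (`not_kDoublingLawFrom`, `not_kDoublingLaw`).  Informative content: «the `K`-axis has no
polynomial-in-`m` doubling, from any threshold on; only the `m`-axis might».
-/

-- `Summit.ValiantsHypothesis.ValiantsHypothesis.…` is the tree's mandated single-conjunct layout (Sub = Summit).
set_option linter.dupNamespace false
set_option autoImplicit false

namespace Summit.ValiantsHypothesis.ValiantsHypothesis.Theorems.KPlusLogSqLaw.KDoubling

open Summit.ValiantsHypothesis.ValiantsHypothesis.Theorems.LacunarySymmetroidMatrixDescartes.TropicalCensus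
open Summit.ValiantsHypothesis.ValiantsHypothesis.Theorems.KPlusLogSqLaw
open Summit.ValiantsHypothesis.ValiantsHypothesis.Theorems.KPlusLogSqLaw.WalkDesign (staircase_lower staircase_format_le)

/-- **The `K`-axis doubling law with constants `(C, c)` from threshold `K₀` on** (candidate shape, NOT asserted; REFUTED below):
doubling the number of classes at fixed size costs a factor `2^{C·K} · m^c` on `T + 1`, for every `K ≥ K₀`.
[candidate of the cell; no citation exists] -/
def KDoublingLawFrom (K₀ C c : ℕ) : Prop :=
  ∀ m K B : ℕ, K₀ ≤ K → TropRootLawAt m K B → TropRootLawAt m (2 * K) (2 ^ (C * K) * m ^ c * (B + 1))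

/-- **The `K`-axis doubling law with constants `(C, c)`** (all `K`; NOT asserted; REFUTED below). [candidate of the cell; no citation exists] -/
def KDoublingLaw (C c : ℕ) : Prop :=
  ∀ m K B : ℕ, TropRootLawAt m K B → TropRootLawAt m (2 * K) (2 ^ (C * K) * m ^ c * (B + 1))

/-- the all-`K` law is the law from threshold `0`. [bookkeeping] -/
theorem kDoublingLawFrom_zero_iff (C c : ℕ) : KDoublingLawFrom 0 C c ↔ KDoublingLaw C c :=
  ⟨fun h m K B hB => h m K B (Nat.zero_le _) hB, fun h m K B _ hB => h m K B hB⟩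

/-- a later threshold asks less. [bookkeeping] -/
theorem KDoublingLawFrom.mono {K₀ K₀' C c : ℕ} (hK : K₀ ≤ K₀') (h : KDoublingLawFrom K₀ C c) : KDoublingLawFrom K₀' C c :=
  fun m K B hK' hB => h m K B (hK.trans hK') hB

/-- one class: a single-class design has no sign-alternating breakpoint, `T(m, 1) = 0` (slope counting `C(m, m) − 1 = 0`). [folklore] -/
theorem tropRootLawAt_one_zero (m : ℕ) : TropRootLawAt m 1 0 := by
  have h := tropRootLawAt_of_tropRowD (tropRowD_choose m 1)
  have h0 : (1 + m - 1).choose m - 1 = 0 := by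
    rw [show 1 + m - 1 = m by omega, Nat.choose_self]
  rwa [h0] at h

/-- slope counting in law currency: `T(m, K) ≤ 2^{K²} · m^{K}` for `m, K ≥ 1` (from `C(K+m−1, m) ≤ (K+m−1)^{K−1} ≤ (K·m)^{K}`). [folklore] -/
theorem tropRootLawAt_slopeCount_pow (m K : ℕ) (hm : 1 ≤ m) (hK : 1 ≤ K) : TropRootLawAt m K (2 ^ (K ^ 2) * m ^ K) := by
  refine tropRootLawAt_mono ?_ (tropRootLawAt_of_tropRowD (tropRowD_choose m K))
  have h1 : (K + m - 1).choose m ≤ (K + m - 1) ^ (K - 1) := by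
    have := Nat.choose_le_pow (K + m - 1) (K - 1)
    rwa [show (K + m - 1).choose (K - 1) = (K + m - 1).choose m from by
      rw [← Nat.choose_symm (by omega : K - 1 ≤ K + m - 1)]; congr 1; omega] at this
  have h2 : K + m - 1 ≤ K * m := by
    obtain ⟨K', rfl⟩ : ∃ K', K = K' + 1 := ⟨K - 1, by omega⟩
    obtain ⟨m', rfl⟩ : ∃ m', m = m' + 1 := ⟨m - 1, by omega⟩
    rw [show (K' + 1) * (m' + 1) = K' * m' + K' + m' + 1 by ring]
    omega
  have h3 : (K + m - 1) ^ (K - 1) ≤ (K * m) ^ K := by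
    calc (K + m - 1) ^ (K - 1) ≤ (K * m) ^ (K - 1) := Nat.pow_le_pow_left h2 _
      _ ≤ (K * m) ^ K := Nat.pow_le_pow_right (Nat.mul_pos (by omega) (by omega)) (Nat.sub_le _ _)
  have h4 : (K * m) ^ K ≤ 2 ^ (K ^ 2) * m ^ K := by
    rw [mul_pow, sq, pow_mul]
    exact Nat.mul_le_mul_right _ (Nat.pow_le_pow_left (Nat.lt_two_pow_self).le _)
  omega

/-- **iterating the `K`-axis law** from a base `T(m, K₁) ≤ 2^a · m^b` (`K₁ ≥ max K₀ 1`, `m ≥ 1`):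
`T(m, K₁·2^j) ≤ 2^{(C+1)·K₁·2^j + a} · m^{c·j + b}`. [folklore] -/
theorem tropRootLawAt_iter_of_kDoublingLawFrom {K₀ C c : ℕ} (h : KDoublingLawFrom K₀ C c) (K₁ : ℕ) (hK₀ : K₀ ≤ K₁)
    (hK₁ : 1 ≤ K₁) (m : ℕ) (hm : 1 ≤ m) (a b : ℕ) (hbase : TropRootLawAt m K₁ (2 ^ a * m ^ b)) :
    ∀ j : ℕ, TropRootLawAt m (K₁ * 2 ^ j) (2 ^ ((C + 1) * K₁ * 2 ^ j + a) * m ^ (c * j + b)) := by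
  intro j
  induction j with
  | zero =>
    refine tropRootLawAt_mono ?_ (by simpa using hbase)
    rw [pow_zero, mul_one, Nat.mul_zero, zero_add, pow_add]
    exact Nat.mul_le_mul_right _ (Nat.le_mul_of_pos_left _ (by positivity))
  | succ j ih =>
    have hKj : K₀ ≤ K₁ * 2 ^ j := hK₀.trans (Nat.le_mul_of_pos_right _ (by positivity))
    have step := h m (K₁ * 2 ^ j) _ hKj ih
    have hK2 : 2 * (K₁ * 2 ^ j) = K₁ * 2 ^ (j + 1) := by rw [pow_succ]; ring
    rw [hK2] at step
    refine tropRootLawAt_mono ?_ step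
    -- `2^{C K} m^c (X + 1) ≤ 2 · 2^{C K} m^c X ≤ 2^{(C+1) K₁ 2^{j+1} + a} m^{c(j+1)+b}`, `K = K₁ 2^j ≥ 1`
    set X := 2 ^ ((C + 1) * K₁ * 2 ^ j + a) * m ^ (c * j + b) with hX
    have hX1 : 1 ≤ X := Nat.le_mul_of_pos_right _ (by positivity) |>.trans' Nat.one_le_two_pow
    have hmc : m ^ (c * (j + 1) + b) = m ^ c * m ^ (c * j + b) := by
      rw [show c * (j + 1) + b = c + (c * j + b) by ring, pow_add]
    have hK1j : 1 ≤ K₁ * 2 ^ j := Nat.mul_pos (by omega) (by positivity)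
    calc 2 ^ (C * (K₁ * 2 ^ j)) * m ^ c * (X + 1)
        ≤ 2 ^ (C * (K₁ * 2 ^ j)) * m ^ c * (2 * X) := Nat.mul_le_mul_left _ (by omega)
      _ = 2 ^ (C * (K₁ * 2 ^ j) + 1 + ((C + 1) * K₁ * 2 ^ j + a)) * (m ^ c * m ^ (c * j + b)) := by
          rw [hX]; ring
      _ ≤ 2 ^ ((C + 1) * K₁ * 2 ^ (j + 1) + a) * m ^ (c * (j + 1) + b) := by
          rw [hmc]
          refine Nat.mul_le_mul_right _ (Nat.pow_le_pow_right (by norm_num) ?_)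
          rw [pow_succ]
          nlinarith

/-- **the staircase beats every bound `2^A · m^b` at `K = L + 1` once `L ≥ 2b + 1`**: if `T(m, L+1) ≤ 2^A · m^b` held for EVERY `m ≥ 1`,
then at the staircase format `m = ((2^L−1)(n+1)+1)·(2^L·n·2) ≤ 2^{2L+2}·n²` with `n = 2·2^A·2^{(2L+2)b} + 2` one would get
`n^L − 1 ≤ 2^A·2^{(2L+2)b}·n^{2b} < n^{2b+1} − 1`. [folklore] -/
theorem staircase_beats_pow (A b L : ℕ) (hL1 : 1 ≤ L) (hLb : 2 * b + 1 ≤ L)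
    (h : ∀ m : ℕ, 1 ≤ m → TropRootLawAt m (L + 1) (2 ^ A * m ^ b)) : False := by
  set D := 2 ^ A * (2 ^ (2 * L + 2)) ^ b with hD
  set n := 2 * D + 2 with hn
  have hn2 : 2 ≤ n := by omega
  have hne : Even n := ⟨D + 1, by omega⟩
  set m := ((2 ^ L - 1) * (n + 1) + 1) * (2 ^ L * n * 2) with hm
  have hm1 : 1 ≤ m := by
    have : 0 < 2 ^ L * n * 2 := by positivity
    have : 0 < m := Nat.mul_pos (Nat.succ_pos _) this
    omega
  have h1 := staircase_lower n L hn2 hne hL1 _ (h m hm1)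
  have hm' : m ≤ 2 ^ (2 * L + 2) * n ^ 2 := staircase_format_le n L (by omega)
  have h2 : 2 ^ A * m ^ b ≤ D * n ^ (2 * b) := by
    calc 2 ^ A * m ^ b ≤ 2 ^ A * (2 ^ (2 * L + 2) * n ^ 2) ^ b := Nat.mul_le_mul_left _ (Nat.pow_le_pow_left hm' _)
      _ = D * n ^ (2 * b) := by rw [hD, mul_pow, ← pow_mul]; ring
  have h3 : n ^ (2 * b) * n ≤ n ^ L := by
    rw [← pow_succ]
    exact Nat.pow_le_pow_right (by omega) hLb
  have h4 : 1 ≤ n ^ (2 * b) := Nat.one_le_pow _ _ (by omega)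
  have h5 : n ^ L - 1 ≤ D * n ^ (2 * b) := h1.trans h2
  have h6 : n ^ (2 * b) * n ≤ D * n ^ (2 * b) + 1 := by omega
  nlinarith

/-- arithmetic for the choice `j = 2c + 2 + K₁`: `2·(c·j + K₁) + 1 + 1 ≤ K₁ · 2^j` for `K₁ ≥ 1`. [folklore] -/
theorem iter_exponent_le (c K₁ : ℕ) (hK₁ : 1 ≤ K₁) :
    2 * (c * (2 * c + 2 + K₁) + K₁) + 1 + 1 ≤ K₁ * 2 ^ (2 * c + 2 + K₁) := by
  have h1 : c + 1 ≤ 2 ^ c := Nat.lt_two_pow_self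
  have h2 : K₁ + 1 ≤ 2 ^ K₁ := Nat.lt_two_pow_self
  have h3 : 2 ^ (2 * c + 2 + K₁) = 4 * (2 ^ c * 2 ^ c) * 2 ^ K₁ := by
    rw [show 2 * c + 2 + K₁ = c + c + 2 + K₁ by ring, pow_add, pow_add, pow_add]; ring
  rw [h3]
  have h4 : 4 * c ^ 2 + 4 * c + 2 ≤ 4 * (2 ^ c * 2 ^ c) := by nlinarith
  calc 2 * (c * (2 * c + 2 + K₁) + K₁) + 1 + 1
      ≤ (4 * c ^ 2 + 4 * c + 2) * (K₁ + 1) := by nlinarith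
    _ ≤ 4 * (2 ^ c * 2 ^ c) * 2 ^ K₁ := Nat.mul_le_mul h4 h2
    _ ≤ K₁ * (4 * (2 ^ c * 2 ^ c) * 2 ^ K₁) := Nat.le_mul_of_pos_left _ (by omega)

/-- **No `K`-axis doubling law from any threshold** (PROVED): for every `(K₀, C, c)` the law
`T(m, 2K) + 1 ≤ 2^{C·K}·m^c·(T(m, K) + 1)` (`K ≥ K₀`) fails somewhere — start the iteration at `K₁ = 2^{K₀}` from slope counting,
run it `j = 2c + 2 + K₁` times, and compare with the staircase at `K = K₁·2^j`. [folklore] -/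
theorem not_kDoublingLawFrom (K₀ C c : ℕ) : ¬ KDoublingLawFrom K₀ C c := by
  intro h
  set K₁ := 2 ^ K₀ with hK₁
  have hK₀ : K₀ ≤ K₁ := (Nat.lt_two_pow_self).le
  have hK₁1 : 1 ≤ K₁ := Nat.one_le_two_pow
  set j := 2 * c + 2 + K₁ with hj
  set K := K₁ * 2 ^ j with hK
  have hKexp : 2 * (c * j + K₁) + 1 + 1 ≤ K := iter_exponent_le c K₁ hK₁1
  set L := K - 1 with hL
  have hLK : L + 1 = K := by omega
  refine staircase_beats_pow ((C + 1) * K₁ * 2 ^ j + K₁ ^ 2) (c * j + K₁) L (by omega) (by omega) fun m hm => ?_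
  rw [hLK]
  exact tropRootLawAt_iter_of_kDoublingLawFrom h K₁ hK₀ hK₁1 m hm (K₁ ^ 2) K₁
    (tropRootLawAt_slopeCount_pow m K₁ hm hK₁1) j

/-- **No `K`-axis doubling law** (all `K`; PROVED): the special case `K₀ = 0`.  Calibration only: the `m`-axis doubling laws of the
registered lines are untouched. [folklore] -/
theorem not_kDoublingLaw (C c : ℕ) : ¬ KDoublingLaw C c :=
  fun h => not_kDoublingLawFrom 0 C c ((kDoublingLawFrom_zero_iff C c).2 h)

end Summit.ValiantsHypothesis.ValiantsHypothesis.Theorems.KPlusLogSqLaw.KDoubling
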